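import Mathlib
import HarnessLib
import Literature.Combinatorics.Enumerative.PfaffSaalschutz

/-!
# HypergeometricWhipple — Whipple's terminating nearly-poised `₄F₃(1)` ↔ Saalschützian `₅F₄(1)` transformation,
denominator-free polynomial form, by Bailey's transform (the classical engine behind Zudilin 2014, Remark 5)

HONEST FRAMING: systematic search; no irrationality claim unless certified.

fam-measure (pub-zeta5), FAMILY.md §10.11, successor task G1.  The growth side of Zudilin's two-tale
`μ(ζ(2))` implications is formal at both kernel rungs modulo the single named statement `WhippleRemark5(Max)`
(`TwoTaleWhipple{,Measures,P15}`), which is Whipple's transformation [L. J. Slater, *Generalized Hypergeometric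
Functions* (1966), (2.4.2.3); F. J. W. Whipple, Proc. LMS (2) 25 (1926) 525–544, §3.5] at `d = −N`:

  `₄F₃[f, 1+f−h, h−a, −N; h, 1+f+a−h, g; 1]
     = ((g−f)_N/(g)_N) · ₅F₄[a, −N, 1+f−g, f/2, (1+f)/2; h, 1+f+a−h, (1+f−N−g)/2, (2+f−N−g)/2; 1]`

written over Zudilin's integer data (`f = a₄, h = a₄−a₁+1, a = a₄−a₁−a₂+1, g = a₄−a₃+1, N = b₄−a₄−1`).
This file proves the transformation itself in the DENOMINATOR-FREE form obtained by multiplying through by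
`(h)_N (1+f+a−h)_N (g)_N` (so that it holds in every commutative ring and specialises to integer parameters
with no `0/0` regularisation — note that the printed `₅F₄` is NOT termwise defined at Zudilin's data, where
`1+f−N−g = a₄−b₄+a₃+1 < 0`):

  **`whipple_nearlyPoised`**:
  `∑_{n=0}^{N} (−1)^n C(N,n) (f)_n (1+f−h)_n (h−a)_n (h+n)_{N−n} (1+f+a−h+n)_{N−n} (g+n)_{N−n}`
  `  = ∑_{r=0}^{N} C(N,r) (a)_r (f)_{2r} (g−f−r)_{N−r} (h+r)_{N−r} (1+f+a−h+r)_{N−r}`,          (W)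

`(z)_m = ∏_{i<m} (z+i)` (`rf z m`).  PROOF (Bailey's transform, Slater §2.4, made finite and polynomial):
(1) `saalschutz_step`: `(1+f−h)_n (h−a)_n = ∑_k (−1)^k C(n,k) (a)_k (f+n)_k (h+k)_{n−k} (1+f+a−h+k)_{n−k}` —
the Literature's PROVED Pfaff–Saalschütz summation `Literature.Combinatorics.Enumerative.pfaffSaalschutz a (f+n) h n`
after two reflections `(1−z−m)_m = (−1)^m (z)_m` (`rf_reflect`); (2) substitute, merge `(f)_n (f+n)_k = (f)_{n+k}`,
`(h+k)_{n−k} (h+n)_{N−n} = (h+k)_{N−k}` (`rf_add`), and interchange the finite sums (`Finset.sum_comm` on the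
square, the binomials vanishing off the triangle); (3) `rf_vandermonde_reflected`: `∑_s (−1)^s C(M,s) (B)_s
(C+s)_{M−s} = (C−B)_M` (Chu–Vandermonde for rising factorials, `rf_vandermonde`, plus reflection) evaluates the
inner sum with `B = f+2r`, `C = g+r`, `M = N−r`, using `C(N,r+s) C(r+s,r) = C(N,r) C(N−r,s)` (`Nat.choose_mul`).
Checked independently in exact arithmetic (`whippleW_check.py`: 540 random rational parameter sets, `N ≤ 8`, and
9072 integer dictionary instances; `slater2423_check.py`: the Bailey pieces and both dictionary lemmas against the
Literature's `formQZ` / `formQTZ` on 3168 admissible instances).  What REMAINS for G1 (not in this file): the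
dictionary `formQZ (firstA …) (firstB …) = (−1)^{N+1} K · LHS(W)/((h)_N (1+f+a−h)_N (g)_N)`-type identifications of
Zudilin's binomial closed forms with the two sides of (W) (FAMILY §10.11, `G1-BLUEPRINT.md`).
-/

namespace Summit.KontsevichZagierPeriods.Zeta5Search.HypergeometricWhipple

open Finset

variable {R : Type*} [CommRing R]

/-! ### Rising factorials as explicit products -/

/-- The rising factorial `(z)_m = z (z+1) ⋯ (z+m−1)` as an explicit product (the convention of
`Literature.Combinatorics.Enumerative.pfaffSaalschutz`). -/
def rf (z : R) (m : ℕ) : R := ∏ i ∈ range m, (z + i)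

/-- `(z)_0 = 1`. -/
theorem rf_zero (z : R) : rf z 0 = 1 := by simp [rf]

/-- `(z)_{m+1} = (z)_m (z+m)`. -/
theorem rf_succ (z : R) (m : ℕ) : rf z (m + 1) = rf z m * (z + m) := by
  simp [rf, prod_range_succ]

/-- `(z)_{m+n} = (z)_m (z+m)_n`. -/
theorem rf_add (z : R) (m n : ℕ) : rf z (m + n) = rf z m * rf (z + m) n := by
  unfold rf
  rw [prod_range_add]
  congr 1
  refine prod_congr rfl fun i _ => ?_
  push_cast; ring

/-- Reflection: `(1 − z − m)_m = (−1)^m (z)_m`. -/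
theorem rf_reflect (z : R) (m : ℕ) : rf (1 - z - m) m = (-1) ^ m * rf z m := by
  induction m with
  | zero => simp [rf]
  | succ m ih =>
    unfold rf at ih ⊢
    rw [prod_range_succ', prod_range_succ]
    have h1 : ∏ i ∈ range m, (1 - z - ((m + 1 : ℕ) : R) + ((i + 1 : ℕ) : R)) =
        ∏ i ∈ range m, (1 - z - (m : R) + (i : R)) :=
      prod_congr rfl fun i _ => by push_cast; ring
    rw [h1, ih]
    push_cast; ring

/-- **Chu–Vandermonde for rising factorials** (antidiagonal form): `(x+y)_n = ∑_{i+j=n} C(n,i) (x)_i (y)_j`.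
[cite: AndrewsAskeyRoy1999, Cor. 2.2.3] -/
theorem rf_vandermonde_antidiagonal (x y : R) (n : ℕ) :
    rf (x + y) n = ∑ ij ∈ antidiagonal n, (n.choose ij.1 : R) * (rf x ij.1 * rf y ij.2) := by
  induction n with
  | zero => simp [rf]
  | succ k ih =>
    rw [rf_succ, ih, Finset.sum_mul,
      Finset.sum_antidiagonal_choose_succ_mul (fun i j => rf x i * rf y j), ← Finset.sum_add_distrib]
    refine Finset.sum_congr rfl fun ij hij => ?_
    have hk : ij.1 + ij.2 = k := mem_antidiagonal.1 hij
    rw [← Nat.choose_symm_of_eq_add hk.symm]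
    simp only [rf_succ]
    have hk' : (k : R) = ij.1 + ij.2 := by rw [← hk, Nat.cast_add]
    rw [hk']
    ring

/-- **Chu–Vandermonde for rising factorials**: `(x+y)_n = ∑_{k=0}^{n} C(n,k) (x)_k (y)_{n−k}`.
[cite: AndrewsAskeyRoy1999, Cor. 2.2.3] -/
theorem rf_vandermonde (x y : R) (n : ℕ) :
    rf (x + y) n = ∑ k ∈ range (n + 1), (n.choose k : R) * (rf x k * rf y (n - k)) := by
  rw [rf_vandermonde_antidiagonal, ← Nat.sum_antidiagonal_eq_sum_range_succ
    (fun k l => (n.choose k : R) * (rf x k * rf y l))]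

/-- **Reflected Chu–Vandermonde** (the terminating Gauss sum `₂F₁(−M, B; C; 1) = (C−B)_M/(C)_M`, polynomial
form): `∑_{s=0}^{M} (−1)^s C(M,s) (B)_s (C+s)_{M−s} = (C−B)_M`. [cite: AndrewsAskeyRoy1999, Cor. 2.2.3] -/
theorem rf_vandermonde_reflected (B C : R) (M : ℕ) :
    ∑ s ∈ range (M + 1), (-1 : R) ^ s * (M.choose s : R) * rf B s * rf (C + s) (M - s) = rf (C - B) M := by
  have h1 : ∀ s ∈ range (M + 1), (-1 : R) ^ s * (M.choose s : R) * rf B s * rf (C + s) (M - s) =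
      (-1 : R) ^ M * ((M.choose s : R) * (rf B s * rf (1 - C - M) (M - s))) := by
    intro s hs
    have hsM : s ≤ M := Nat.lt_succ_iff.mp (mem_range.mp hs)
    have hb : (C + s : R) = 1 - (1 - C - M) - ((M - s : ℕ) : R) := by
      push_cast [Nat.cast_sub hsM]; ring
    have hsgn : (-1 : R) ^ M = (-1) ^ s * (-1) ^ (M - s) := by
      rw [← pow_add, Nat.add_sub_cancel' hsM]
    rw [hb, rf_reflect, hsgn]
    ring
  rw [sum_congr rfl h1, ← Finset.mul_sum, ← rf_vandermonde,
    show (B + (1 - C - M) : R) = 1 - (C - B) - M by ring, rf_reflect, ← mul_assoc, ← mul_pow]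
  simp

/-! ### The Saalschütz step -/

/-- **The Saalschütz step of Bailey's transform**: `(1+f−h)_n (h−a)_n = ∑_{k=0}^{n} (−1)^k C(n,k) (a)_k (f+n)_k
(h+k)_{n−k} (1+f+a−h+k)_{n−k}` — the balanced `₃F₂[−n, a, f+n; h, 1+f+a−h; 1]` evaluation, i.e. the Literature's
`pfaffSaalschutz a (f+n) h n` with its two "negative" rising factorials reflected.
[cite: AndrewsAskeyRoy1999, Thm. 2.2.6] -/
theorem saalschutz_step (f h a : R) (n : ℕ) :
    rf (1 + f - h) n * rf (h - a) n = ∑ k ∈ range (n + 1), (-1 : R) ^ k * (n.choose k : R) * rf a k *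
      rf (f + n) k * rf (h + k) (n - k) * rf (1 + f + a - h + k) (n - k) := by
  have hPS : ∑ k ∈ range (n + 1), (n.choose k : R) * rf a k * rf (f + n) k * rf (h + k) (n - k) *
      rf (h - a - (f + n)) (n - k) = rf (h - a) n * rf (h - (f + n)) n := by
    simpa only [rf] using Literature.Combinatorics.Enumerative.pfaffSaalschutz a (f + n) h n
  have h2 : ∀ k ∈ range (n + 1), (n.choose k : R) * rf a k * rf (f + n) k * rf (h + k) (n - k) *
      rf (h - a - (f + n)) (n - k) = (-1 : R) ^ n * ((-1 : R) ^ k * (n.choose k : R) * rf a k *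
      rf (f + n) k * rf (h + k) (n - k) * rf (1 + f + a - h + k) (n - k)) := by
    intro k hk
    have hkn : k ≤ n := Nat.lt_succ_iff.mp (mem_range.mp hk)
    have hb : (h - a - (f + n) : R) = 1 - (1 + f + a - h + k) - ((n - k : ℕ) : R) := by
      push_cast [Nat.cast_sub hkn]; ring
    have hsgn : (-1 : R) ^ (n - k) = (-1) ^ n * (-1) ^ k := by
      have h1 : (-1 : R) ^ n = (-1) ^ (n - k) * (-1) ^ k := by rw [← pow_add, Nat.sub_add_cancel hkn]
      rw [h1, mul_assoc, ← mul_pow]; simp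
    rw [hb, rf_reflect, hsgn]; ring
  rw [sum_congr rfl h2, ← Finset.mul_sum, show (h - (f + n) : R) = 1 - (1 + f - h) - n by ring,
    rf_reflect] at hPS
  -- cancel the unit `(-1)^n`
  have hu : (-1 : R) ^ n * (-1) ^ n = 1 := by rw [← mul_pow]; simp
  calc rf (1 + f - h) n * rf (h - a) n
      = ((-1 : R) ^ n * (-1) ^ n) * (rf (1 + f - h) n * rf (h - a) n) := by rw [hu, one_mul]
    _ = (-1 : R) ^ n * (rf (h - a) n * ((-1) ^ n * rf (1 + f - h) n)) := by ring
    _ = (-1 : R) ^ n * ((-1 : R) ^ n * ∑ k ∈ range (n + 1), (-1 : R) ^ k * (n.choose k : R) * rf a k *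
          rf (f + n) k * rf (h + k) (n - k) * rf (1 + f + a - h + k) (n - k)) := by rw [hPS]
    _ = _ := by rw [← mul_assoc, hu, one_mul]

/-! ### Whipple's transformation, terminating polynomial form -/

/-- The `n`-th term of the nearly-poised side of (W): `(−1)^n C(N,n) (f)_n (1+f−h)_n (h−a)_n (h+n)_{N−n}
(1+f+a−h+n)_{N−n} (g+n)_{N−n}`. -/
def nearlyPoisedTerm (f h a g : R) (N n : ℕ) : R :=
  (-1 : R) ^ n * (N.choose n : R) * rf f n * rf (1 + f - h) n * rf (h - a) n *
    rf (h + n) (N - n) * rf (1 + f + a - h + n) (N - n) * rf (g + n) (N - n)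

/-- The `r`-th term of the Saalschützian side of (W): `C(N,r) (a)_r (f)_{2r} (g−f−r)_{N−r} (h+r)_{N−r}
(1+f+a−h+r)_{N−r}`. -/
def saalschutzianTerm (f h a g : R) (N r : ℕ) : R :=
  (N.choose r : R) * rf a r * rf f (2 * r) * rf (g - f - r) (N - r) * rf (h + r) (N - r) *
    rf (1 + f + a - h + r) (N - r)

/-- The expanded double summand of Bailey's transform: `(−1)^{n+k} C(N,n) C(n,k) (a)_k (f)_{n+k} (h+k)_{N−k}
(1+f+a−h+k)_{N−k} (g+n)_{N−n}` (vanishes off the triangle `k ≤ n ≤ N`). -/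
def baileyTerm (f h a g : R) (N n k : ℕ) : R :=
  (-1 : R) ^ (n + k) * (N.choose n : R) * (n.choose k : R) * rf a k * rf f (n + k) *
    rf (h + k) (N - k) * rf (1 + f + a - h + k) (N - k) * rf (g + n) (N - n)

/-- Row expansion: for `n ≤ N`, the nearly-poised term is `∑_{k=0}^{N}` of the Bailey summand (Saalschütz step,
then `(f)_n (f+n)_k = (f)_{n+k}`, `(h+k)_{n−k} (h+n)_{N−n} = (h+k)_{N−k}`). -/
theorem nearlyPoisedTerm_eq_sum (f h a g : R) {N n : ℕ} (hn : n ≤ N) :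
    nearlyPoisedTerm f h a g N n = ∑ k ∈ range (N + 1), baileyTerm f h a g N n k := by
  have hext : ∑ k ∈ range (N + 1), baileyTerm f h a g N n k = ∑ k ∈ range (n + 1), baileyTerm f h a g N n k := by
    have hsub : range (n + 1) ⊆ range (N + 1) := by
      intro x hx
      simp only [mem_range] at hx ⊢
      omega
    symm
    apply sum_subset hsub
    intro k hk hk'
    have hlt : n < k := by
      simp only [mem_range, not_lt] at hk hk'
      omega
    simp [baileyTerm, Nat.choose_eq_zero_of_lt hlt]
  rw [hext]
  calc nearlyPoisedTerm f h a g N n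
      = (-1 : R) ^ n * (N.choose n : R) * rf f n * rf (h + n) (N - n) * rf (1 + f + a - h + n) (N - n) *
          rf (g + n) (N - n) * (rf (1 + f - h) n * rf (h - a) n) := by unfold nearlyPoisedTerm; ring
    _ = ∑ k ∈ range (n + 1), (-1 : R) ^ n * (N.choose n : R) * rf f n * rf (h + n) (N - n) *
          rf (1 + f + a - h + n) (N - n) * rf (g + n) (N - n) * ((-1 : R) ^ k * (n.choose k : R) * rf a k *
          rf (f + n) k * rf (h + k) (n - k) * rf (1 + f + a - h + k) (n - k)) := by
        rw [saalschutz_step, Finset.mul_sum]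
    _ = ∑ k ∈ range (n + 1), baileyTerm f h a g N n k := by
        refine sum_congr rfl fun k hk => ?_
        have hkn : k ≤ n := Nat.lt_succ_iff.mp (mem_range.mp hk)
        have e1 : rf f (n + k) = rf f n * rf (f + n) k := rf_add f n k
        have e2 : rf (h + k) (N - k) = rf (h + k) (n - k) * rf (h + n) (N - n) := by
          have := rf_add (h + k) (n - k) (N - n)
          rw [show n - k + (N - n) = N - k by omega] at this
          rw [this]; congr 2; push_cast [Nat.cast_sub hkn]; ring
        have e3 : rf (1 + f + a - h + k) (N - k) =
            rf (1 + f + a - h + k) (n - k) * rf (1 + f + a - h + n) (N - n) := by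
          have := rf_add (1 + f + a - h + k) (n - k) (N - n)
          rw [show n - k + (N - n) = N - k by omega] at this
          rw [this]; congr 2; push_cast [Nat.cast_sub hkn]; ring
        unfold baileyTerm
        rw [e1, e2, e3, pow_add]; ring

/-- Column evaluation: for `r ≤ N`, `∑_{n=0}^{N}` of the Bailey summand is the Saalschützian term (shift
`n = r + s`, `C(N,r+s) C(r+s,r) = C(N,r) C(N−r,s)`, `(f)_{2r+s} = (f)_{2r} (f+2r)_s`, reflected Chu–Vandermonde). -/
theorem sum_baileyTerm_eq (f h a g : R) {N r : ℕ} (hr : r ≤ N) :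
    ∑ n ∈ range (N + 1), baileyTerm f h a g N n r = saalschutzianTerm f h a g N r := by
  have hvan : ∑ n ∈ range (N + 1), baileyTerm f h a g N n r = ∑ n ∈ Ico r (N + 1), baileyTerm f h a g N n r := by
    symm
    apply sum_subset
    · intro x hx
      simp only [mem_Ico] at hx
      exact mem_range.2 hx.2
    · intro n hn hn'
      have hlt : n < r := by
        simp only [mem_range, mem_Ico, not_and, not_lt] at hn hn'
        by_contra hc
        exact absurd (hn' (not_lt.mp hc)) (not_le.mpr hn)
      simp [baileyTerm, Nat.choose_eq_zero_of_lt hlt]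
  rw [hvan, Finset.sum_Ico_eq_sum_range, show N + 1 - r = N - r + 1 by omega]
  have inner : ∀ s ∈ range (N - r + 1), baileyTerm f h a g N (r + s) r =
      (N.choose r : R) * rf a r * rf f (2 * r) * rf (h + r) (N - r) * rf (1 + f + a - h + r) (N - r) *
        ((-1 : R) ^ s * ((N - r).choose s : R) * rf (f + 2 * r) s * rf (g + r + s) (N - r - s)) := by
    intro s hs
    have hs' : s ≤ N - r := Nat.lt_succ_iff.mp (mem_range.mp hs)
    have sgn : (-1 : R) ^ (r + s + r) = (-1) ^ s := by
      rw [show r + s + r = s + 2 * r by ring, pow_add, pow_mul]; simp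
    have ch : (N.choose (r + s) : R) * ((r + s).choose r : R) = (N.choose r : R) * ((N - r).choose s : R) := by
      have := Nat.choose_mul (n := N) (k := r + s) (s := r) (by omega)
      rw [show r + s - r = s by omega] at this
      have hc := congrArg (Nat.cast (R := R)) this
      push_cast at hc
      exact hc
    have e4 : rf f (r + s + r) = rf f (2 * r) * rf (f + 2 * r) s := by
      rw [show r + s + r = 2 * r + s by ring, rf_add]; push_cast; ring_nf
    have e5 : rf (g + ((r + s : ℕ) : R)) (N - (r + s)) = rf (g + r + s) (N - r - s) := by
      rw [show N - (r + s) = N - r - s by omega]; push_cast; ring_nf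
    unfold baileyTerm
    rw [sgn, e4, e5]
    linear_combination ((-1 : R) ^ s * rf a r * rf f (2 * r) * rf (f + 2 * r) s * rf (h + r) (N - r) *
      rf (1 + f + a - h + r) (N - r) * rf (g + r + s) (N - r - s)) * ch
  rw [sum_congr rfl inner, ← Finset.mul_sum, rf_vandermonde_reflected (f + 2 * r) (g + r) (N - r),
    show (g + r - (f + 2 * r) : R) = g - f - r by ring]
  unfold saalschutzianTerm; ring

/-- **Whipple's transformation of a terminating nearly-poised `₄F₃(1)` into a Saalschützian `₅F₄(1)`,
denominator-free polynomial form (W)** [Slater (2.4.2.3) with `d = −N`, multiplied by `(h)_N (1+f+a−h)_N (g)_N`;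
Whipple 1926, §3.5]: for `f h a g` in any commutative ring and `N ∈ ℕ`,
`∑_{n=0}^{N} (−1)^n C(N,n) (f)_n (1+f−h)_n (h−a)_n (h+n)_{N−n} (1+f+a−h+n)_{N−n} (g+n)_{N−n}
 = ∑_{r=0}^{N} C(N,r) (a)_r (f)_{2r} (g−f−r)_{N−r} (h+r)_{N−r} (1+f+a−h+r)_{N−r}`.  Proof: Bailey's transform
(`nearlyPoisedTerm_eq_sum`, `Finset.sum_comm`, `sum_baileyTerm_eq`). [cite: Slater1966, (2.4.2.3)] -/
theorem whipple_nearlyPoised_terms (f h a g : R) (N : ℕ) :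
    ∑ n ∈ range (N + 1), nearlyPoisedTerm f h a g N n = ∑ r ∈ range (N + 1), saalschutzianTerm f h a g N r := by
  rw [sum_congr rfl fun n hn => nearlyPoisedTerm_eq_sum f h a g (Nat.lt_succ_iff.mp (mem_range.mp hn)),
    Finset.sum_comm]
  exact sum_congr rfl fun r hr => sum_baileyTerm_eq f h a g (Nat.lt_succ_iff.mp (mem_range.mp hr))

/-- **Whipple's transformation (W), explicit form** — see `whipple_nearlyPoised_terms`.
(Whipple 1926, §3.5) [cite: Slater1966, (2.4.2.3)] -/
theorem whipple_nearlyPoised (f h a g : R) (N : ℕ) :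
    ∑ n ∈ range (N + 1), (-1 : R) ^ n * (N.choose n : R) * rf f n * rf (1 + f - h) n * rf (h - a) n *
        rf (h + n) (N - n) * rf (1 + f + a - h + n) (N - n) * rf (g + n) (N - n) =
      ∑ r ∈ range (N + 1), (N.choose r : R) * rf a r * rf f (2 * r) * rf (g - f - r) (N - r) *
        rf (h + r) (N - r) * rf (1 + f + a - h + r) (N - r) :=
  whipple_nearlyPoised_terms f h a g N

/-- (W) with Mathlib's `ascPochhammer` (`(ascPochhammer R m).eval z = (z)_m`). -/
theorem rf_eq_ascPochhammer_eval (z : R) (m : ℕ) : rf z m = (ascPochhammer R m).eval z := by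
  induction m with
  | zero => simp [rf]
  | succ m ih => rw [rf_succ, ih, ascPochhammer_succ_eval]

end Summit.KontsevichZagierPeriods.Zeta5Search.HypergeometricWhipple
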